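import Literature.NumberTheory.GaloisRepresentations.PstWeilDeligneCyclotomicWeight
import Literature.NumberTheory.GaloisRepresentations.UnramifiedLabelledWeights
import HarnessLib

/-!
# The clause "the powers of the cyclotomic character have labelled Hodge–Tate weights `{-m}`"
# for `p`-adic Hodge data — candidate clause (F8) of `IsFontaineDatum` — and its failure for `K̂_nr`

Topic `Literature/NumberTheory/GaloisRepresentations`; companion of the accepted
`PstWeilDeligneCyclotomicWeight` (the UNLABELLED non-truncation clause (F2)
`PstWeilDeligneData.CyclotomicWeightNegOne`), `LabelledHodgeTateWeights` (`HT_τ`) and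
`Literature.NumberTheory.PAdicHodge.FontaineDpst` (the specification `IsFontaineDatum` (F1)–(F7)
of Fontaine's pinned datum and its "Upgrade path": literature seats may ADD clauses that are
theorems for the genuine datum).

## Mathematics

For Fontaine's de Rham period ring `B_dR(K)` of a `p`-adic field `K` and every `m ∈ ℤ`, the
`m`-th power `ε^m : Γ_K → ℚ_p^×` of the `p`-adic cyclotomic character has
`D_dR(ℚ_p(m)) = (B_dR ⊗ ε^m)^{Γ_K} = K · t^{-m} ⊗ e` (`σ t = ε(σ) t`, Fontaine 1994, Exp. II
§1.5.5, Exp. III §1.5.4–1.5.5), a free `K ⊗_{ℚ_p} ℚ̄_p`-module of rank one after extending the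
coefficients to `ℚ̄_p`, on whose `τ`-component (for each `ℚ_p`-embedding `τ : K → ℚ̄_p`) the Hodge
filtration `Fil^i = t^i B_dR^+` jumps exactly in degree `-m`.  Hence, in the convention of the
accepted `PeriodRingData.labelledHodgeTateWeights` (Patrikis 2019 §2.3.1, §2.7.1;
Barnet-Lamb–Gee–Geraghty–Taylor 2014, Notation: "`HT_τ(ε_l) = {-1}`"; Buzzard–Gee 2014 §2.4),
**`HT_τ(ε^m) = {-m}` for every `τ` and every `m ∈ ℤ`.**

The accepted clauses (F1)–(F7) of `IsFontaineDatum` do not imply this: (F2) is the unlabelled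
interval condition `IsDeRhamWithWeightsIn (-1) (-1)` on a finite `ℚ_p`-model of `ε` itself, and
no clause concerns `ε^m` for `m ∉ {0, 1}` or labelled weights (docstring of `FontaineDpst`: "a
statement about `fontainePst` is provable exactly when it holds for EVERY datum satisfying the
clauses").  Yet the pin conjunct of every `∃ RD`-slice of the routes `Langlands/WachComponentCensus`
(`LiftB2Unram`, `LiftB2UnramSmallF`, `LiftB2UnramLargeF`, `LiftB2UnramSplitP`) and
`Langlands/TriangulineChamber` (`LiftB2CrysGeneric`, `…UnramifiedP`, `…RamifiedP`, `…SplitP`) is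
precisely this statement for the pinned datum of each completion `F_v`, `v ∣ p` (reductions
`Summit.Langlands.Langlands.Theorems.LiftB2CrysSplitP.pin_of_localPin`,
`Summit.Langlands.Langlands.Theorems.pin_of_localClause`).

## What this file provides (no `sorry`, no named fact)

* `PstWeilDeligneData.CyclotomicPowersLabelledWeights 𝔇` — **the clause**, a predicate on the
  datum in the style of `CyclotomicWeightNegOne` / `UnramifiedWeightsZero`, worded EXACTLY as the
  routes' local pin: for every `m : ℤ`, every rank-one framed `χ : Γ_K →ₜ* GL₁(ℚ̄_p)` whose entry
  is `ε_K(σ)^m` (through `ℤ_p → ℚ_p → ℚ̄_p`), and every `ℚ_p`-algebra embedding `τ : K → ℚ̄_p`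
  for the datum's `ℚ_p`-structure `𝔇.algebra`, `𝔇.𝔅.labelledHodgeTateWeights χ τ = {-m}`.
  Adding it as clause (F8) of `IsFontaineDatum` (a theorem for the genuine datum, as required by
  the upgrade path) discharges those pins from `FontaineDatumExists` in one line each.
* API: `CyclotomicPowersLabelledWeights.cyclotomicPadicAlgCl` (`m = 1`: `HT_τ(ε) = {-1}`),
  `CyclotomicPowersLabelledWeights.eq_of_entry` (the general unfolding).
* PROVED `not_cyclotomicPowersLabelledWeights_unramifiedPstWeilDeligneData`: **the truncated
  datum `K̂_nr` violates the clause** as soon as `K` admits a `ℚ_p`-embedding into `ℚ̄_p` (all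
  its labelled weights are `0`, accepted `labelledHodgeTateWeights_unramifiedPeriodRingData`), so
  — like (F2) — the clause is not met by inertia-invariant truncations of `B_dR`.

This file does not import `FontaineDpst` (it is meant to be imported BY it).

## References

* J.-M. Fontaine, *Le corps des périodes p-adiques* (Exp. II, §1.5.5) and *Représentations
  p-adiques semi-stables* (Exp. III, §1.5.4–1.5.5), Astérisque 223 (1994). [FontaineAsterisque223III]
* S. Patrikis, *Variations on a theorem of Tate*, Mem. AMS 258 (2019), §2.3.1, §2.7.1. [Patrikis2019]
* T. Barnet-Lamb, T. Gee, D. Geraghty, R. Taylor, *Potential automorphy and change of weight*,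
  Ann. of Math. 179 (2014), Introduction, Notation. [BarnetlambEtAl2014]
* K. Buzzard, T. Gee, *The conjectural connections between automorphic representations and
  Galois representations* (2014), §2.4. [BuzzardGeeLMS2014]
-/

noncomputable section

open scoped MatrixGroups
open Field

namespace Literature.NumberTheory.GaloisRepresentations

open IsNonarchimedeanLocalField

section Pst

variable {K : Type} [Field K] [ValuativeRel K] [TopologicalSpace K] [IsNonarchimedeanLocalField K]
  {p : ℕ} [Fact p.Prime]

namespace PstWeilDeligneData

/-- **Clause (F8): the powers of the cyclotomic character have `τ`-labelled Hodge–Tate weights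
`{-m}`.**  For the `p`-adic Hodge datum `𝔇` of the `p`-adic field `K` (intended: Fontaine's
`B_dR(K)`): for every `m : ℤ`, every rank-one framed representation `χ : Γ_K →ₜ* GL₁(ℚ̄_p)`
whose entry is `ε_K(σ)^m` (the `p`-adic cyclotomic character through `ℤ_p → ℚ_p → ℚ̄_p`), and
every `ℚ_p`-algebra embedding `τ : K → ℚ̄_p` for the datum's `ℚ_p`-structure `𝔇.algebra`, the
multiset of `τ`-labelled Hodge–Tate weights of `χ` relative to `𝔇.𝔅` is `{-m}`.  TRUE for the
genuine datum: `D_dR(ℚ_p(m)) = K · t^{-m} ⊗ e`, `Fil^i B_dR = t^i B_dR^+` (Fontaine 1994, Exp. III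
§1.5; Barnet-Lamb–Gee–Geraghty–Taylor, Notation: `HT_τ(ε) = {-1}`).  Worded exactly as the local
pin of the `∃ RD`-slices of `Langlands/WachComponentCensus` and `Langlands/TriangulineChamber`.
[cite: FontaineAsterisque223III, Exp. III §1.5] [cite: BarnetlambEtAl2014, Introduction (Notation)] -/
def CyclotomicPowersLabelledWeights (𝔇 : PstWeilDeligneData K p) : Prop :=
  ∀ (m : ℤ) (χ : FramedGaloisRep K (PadicAlgCl p) 1),
    (∀ σ, (χ σ).val 0 0 = algebraMap ℚ_[p] (PadicAlgCl p)
      ((((GaloisRep.cyclotomicCharacter K p σ : ℤ_[p]ˣ) : ℤ_[p]) : ℚ_[p]) ^ m)) →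
    letI := 𝔇.algebra
    ∀ τ : K →ₐ[ℚ_[p]] PadicAlgCl p,
      𝔇.𝔅.labelledHodgeTateWeights χ.toGaloisRep τ.toRingHom = {-m}

/-- Unfolding lemma for `CyclotomicPowersLabelledWeights`. [folklore] -/
lemma cyclotomicPowersLabelledWeights_iff (𝔇 : PstWeilDeligneData K p) :
    𝔇.CyclotomicPowersLabelledWeights ↔
      ∀ (m : ℤ) (χ : FramedGaloisRep K (PadicAlgCl p) 1),
        (∀ σ, (χ σ).val 0 0 = algebraMap ℚ_[p] (PadicAlgCl p)
          ((((GaloisRep.cyclotomicCharacter K p σ : ℤ_[p]ˣ) : ℤ_[p]) : ℚ_[p]) ^ m)) →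
        letI := 𝔇.algebra
        ∀ τ : K →ₐ[ℚ_[p]] PadicAlgCl p,
          𝔇.𝔅.labelledHodgeTateWeights χ.toGaloisRep τ.toRingHom = {-m} :=
  Iff.rfl

/-- Under the clause, a rank-one framed `χ` with entries `ε_K^m` has `HT_τ(χ) = {-m}` at every
`ℚ_p`-embedding `τ` (the clause, applied). [folklore] -/
lemma CyclotomicPowersLabelledWeights.eq_of_entry {𝔇 : PstWeilDeligneData K p}
    (h : 𝔇.CyclotomicPowersLabelledWeights) (m : ℤ) (χ : FramedGaloisRep K (PadicAlgCl p) 1)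
    (hχ : ∀ σ, (χ σ).val 0 0 = algebraMap ℚ_[p] (PadicAlgCl p)
      ((((GaloisRep.cyclotomicCharacter K p σ : ℤ_[p]ˣ) : ℤ_[p]) : ℚ_[p]) ^ m)) :
    letI := 𝔇.algebra
    ∀ τ : K →ₐ[ℚ_[p]] PadicAlgCl p,
      𝔇.𝔅.labelledHodgeTateWeights χ.toGaloisRep τ.toRingHom = {-m} :=
  h m χ hχ

/-- Under the clause the cyclotomic character itself (`FramedGaloisRep.cyclotomicPadicAlgCl`,
`m = 1`) has `HT_τ(ε) = {-1}` at every `ℚ_p`-embedding `τ` — the labelled form of (F2).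
[cite: BarnetlambEtAl2014, Introduction (Notation)] -/
lemma CyclotomicPowersLabelledWeights.cyclotomicPadicAlgCl {𝔇 : PstWeilDeligneData K p}
    (h : 𝔇.CyclotomicPowersLabelledWeights) :
    letI := 𝔇.algebra
    ∀ τ : K →ₐ[ℚ_[p]] PadicAlgCl p,
      𝔇.𝔅.labelledHodgeTateWeights
        (FramedGaloisRep.toGaloisRep (FramedGaloisRep.cyclotomicPadicAlgCl K p))
        τ.toRingHom = {-1} :=
  h 1 (FramedGaloisRep.cyclotomicPadicAlgCl K p) fun σ => by
    rw [zpow_one, FramedGaloisRep.cyclotomicPadicAlgCl_apply_coe]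

end PstWeilDeligneData

/-! ### The truncated datum violates the clause -/

/-- **The truncated datum `K̂_nr` violates clause (F8)**: for
`𝔇 = unramifiedPstWeilDeligneData K p` (period ring `K̂_nr`, trivial filtration; installed with
the ambient `ℚ_p`-structure) every labelled Hodge–Tate weight of every representation is `0`
(accepted `labelledHodgeTateWeights_unramifiedPeriodRingData`), so `HT_τ(ε) = {-1}` fails at any
`ℚ_p`-embedding `τ : K → ℚ̄_p` (one exists as soon as `K/ℚ_p` is algebraic, e.g. finite).  Hence
an existence fact over `PstWeilDeligneData K p` that includes the clause is not discharged by this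
datum. [folklore] -/
theorem not_cyclotomicPowersLabelledWeights_unramifiedPstWeilDeligneData [Algebra ℚ_[p] K]
    (τ : K →ₐ[ℚ_[p]] PadicAlgCl p) :
    ¬ (unramifiedPstWeilDeligneData K p).CyclotomicPowersLabelledWeights := by
  intro h
  have h1 := h.cyclotomicPadicAlgCl τ
  change (unramifiedPeriodRingData K p).labelledHodgeTateWeights
      (FramedGaloisRep.toGaloisRep (FramedGaloisRep.cyclotomicPadicAlgCl K p)) τ.toRingHom =
      {-1} at h1
  rw [labelledHodgeTateWeights_unramifiedPeriodRingData] at h1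
  have hmem : (-1 : ℤ) ∈ Multiset.replicate (Module.finrank (PadicAlgCl p)
      ((unramifiedPeriodRingData K p).labelD
        (FramedGaloisRep.toGaloisRep (FramedGaloisRep.cyclotomicPadicAlgCl K p))
        τ.toRingHom)) 0 := by
    rw [h1]
    exact Multiset.mem_singleton_self _
  exact absurd (Multiset.eq_of_mem_replicate hmem) (by norm_num)

/-- Reformulation: a datum with clause (F8) is not the truncated datum (given a `ℚ_p`-embedding
`K → ℚ̄_p`). [folklore] -/
theorem PstWeilDeligneData.CyclotomicPowersLabelledWeights.ne_unramifiedPstWeilDeligneData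
    [Algebra ℚ_[p] K] (τ : K →ₐ[ℚ_[p]] PadicAlgCl p) {𝔇 : PstWeilDeligneData K p}
    (h : 𝔇.CyclotomicPowersLabelledWeights) : 𝔇 ≠ unramifiedPstWeilDeligneData K p := by
  rintro rfl
  exact not_cyclotomicPowersLabelledWeights_unramifiedPstWeilDeligneData τ h

end Pst

end Literature.NumberTheory.GaloisRepresentations

end
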